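import Summits.Ventures.PercRepro.S3LPTrim

/-!
# PercRepro — THE CELL KIT: the LP rows as `range`-sums with the numerals as arguments (p8 g16, S3; on p2's S2LP
machinery and S3LPTrim)

A level-`q` LP cell (`S3LPCellP<p>D<d>`) instantiates several hundred rows of p2's nullity-split coloop/closure LP and
combines them by `linear_combination`. The instances of S2LPInstances / S2LPIncidence / S2LPUnsplit sum over intervals
`Icc a b`; a cell consumer expanded every such sum by hand (`Icc a b = {a, …, b}`, `sum_insert` × (b − a)), ≈ 600 bytes per
row. The lemmas below restate the rows used by a cell as sums over `range` (expanded by `Finset.sum_range_succ` in one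
`simp only` call), with the matroid's point count and the class bounds as explicit arguments, and give short names to the
zero-class facts. Nothing else is claimed; every statement is a rewriting of the cited S2LP / S3LP lemma.

* `sum_Icc_eq_sum_range`, `yRow`, `yrRow`, `uD` (the `U`/`Y` sides), `pRowLe` / `pRowGe` (the partition rows),
  `sRow1` / `sRow2` / `sRowN` (the class partitions), `eRow` (the extension rows), `upx0` / `upx1` / `upxN` (the exact
  upward identities), `clx0_any` / `clx0_col` / `clx0_flat` / `clx1_any` / `clx1_col` / `clx1_flat` / `clxN_any` /
  `clxN_col` / `clxN_flat` (the exact closure instances), `z_lt` / `z_two` / `z_lines` / `z_flat` / `z_col` /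
  `nz_zero` / `nz_two` / `nz_three` / `nz_four` / `nz_five` / `nz_six` / `nz_rk` (the zero classes), `upTop` (the unsplit
  upward row at nullity `0`, for the cells solved without a nullity split).
Axioms: standard.
-/

open scoped Matroid

namespace PercRepro

namespace S3LP

open Set Finset S2LP

variable {α : Type} {M : Matroid α} [M.Finite]

/-- A sum over `Icc a b` as a sum over `range (b + 1 − a)`. -/
theorem sum_Icc_eq_sum_range (f : ℕ → ℕ) (a b : ℕ) :
    ∑ i ∈ Finset.Icc a b, f i = ∑ i ∈ Finset.range (b + 1 - a), f (a + i) := by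
  rw [← Finset.Ico_add_one_right_eq_Icc, Finset.sum_Ico_eq_sum_range]

/-- **The `Y`-sum** over the rank levels `q < r < p` as a `range`-sum. -/
theorem yRow (q p : ℕ) :
    Matroid.midCount M p q = ∑ i ∈ Finset.range (p - (q + 1)), (S1.rankSet M (q + 1 + i)).ncard := by
  have h := S1.ncard_Y_eq_sum (M := M) q p
  rw [← Finset.Ico_add_one_left_eq_Ioo, Finset.sum_Ico_eq_sum_range] at h
  exact h

/-- **The rank classes inside a level**: `Σ_{lo ≤ k ≤ hi} m[k, r] ≤ #rankSet r`. -/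
theorem yrRow (r lo hi : ℕ) :
    ∑ i ∈ Finset.range (hi + 1 - lo), (S1.rkSets M (lo + i) r).ncard ≤ (S1.rankSet M r).ncard := by
  have h := S1.sum_ncard_rkSets_le_ncard_rankSet (M := M) r (Finset.Icc lo hi)
  rwa [sum_Icc_eq_sum_range] at h

/-- **`#uSets k ≤ m[n − k, p]`** with the point count `n`. -/
theorem uD {n : ℕ} (hn : M.E.ncard = n) (p q k : ℕ) :
    (uSets M p q k).ncard ≤ (S1.rkSets M (n - k) p).ncard := by
  have h := ncard_uSets_le_rkSets_compl (M := M) p q k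
  rwa [hn] at h

/-- **The partition row, lower bound**: `C(n, k) ≤ Σ_{lo ≤ r ≤ hi} m[k, r]` over the nonempty ranks. -/
theorem pRowLe {p n : ℕ} (hM : M.eRank = (p : ℕ∞)) (hpairs : ∀ e ∈ M.E, ∀ f ∈ M.E, e ≠ f → M.eRk {e, f} = 2)
    (hcol : M.coloops = ∅) (hn : M.E.ncard = n) (k lo hi C : ℕ) (hk : 2 ≤ k)
    (hlohi : (max 2 (min (k + p + 1 - n) p), min k p) = (lo, hi)) (hC : Nat.choose n k = C) :
    C ≤ ∑ i ∈ Finset.range (hi + 1 - lo), (S1.rkSets M k (lo + i)).ncard := by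
  have h := S1.choose_le_sum_ncard_rkSets hM hpairs hk
  rw [hn, sum_Icc_rkSets_eq hM hcol hn k, sum_Icc_eq_sum_range, hC] at h
  simp only [Prod.mk.injEq] at hlohi
  rw [hlohi.1, hlohi.2] at h
  exact h

/-- **The partition row, upper bound**: `Σ_{lo ≤ r ≤ hi} m[k, r] ≤ C(n, k)`. -/
theorem pRowGe {p n : ℕ} (hM : M.eRank = (p : ℕ∞)) (hcol : M.coloops = ∅) (hn : M.E.ncard = n)
    (k lo hi C : ℕ) (hlohi : (max 2 (min (k + p + 1 - n) p), min k p) = (lo, hi)) (hC : Nat.choose n k = C) :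
    ∑ i ∈ Finset.range (hi + 1 - lo), (S1.rkSets M k (lo + i)).ncard ≤ C := by
  have h := sum_ncard_rkSets_le_choose (M := M) k (Finset.Icc 2 p)
  rw [hn, sum_Icc_rkSets_eq hM hcol hn k, sum_Icc_eq_sum_range, hC] at h
  simp only [Prod.mk.injEq] at hlohi
  rw [hlohi.1, hlohi.2] at h
  exact h

/-- **The nullity-`1` class partition**: `m[k + 1, k] = Σ_{3 ≤ s ≤ k + 1} #nuSets (k + 1) 1 s`. -/
theorem sRow1 (hpairs : ∀ e ∈ M.E, ∀ f ∈ M.E, e ≠ f → M.eRk {e, f} = 2) (hE2 : 2 ≤ M.E.ncard) (k : ℕ) :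
    (S1.rkSets M (k + 1) k).ncard = ∑ i ∈ Finset.range (k + 2 - 3), (nuSets M (k + 1) 1 (3 + i)).ncard := by
  have h := ncard_rkSets_eq_sum_nuSets (M := M) k k (by omega)
  rw [Nat.add_sub_cancel_left, sum_range_nuSets_one_eq hpairs hE2 k, sum_Icc_eq_sum_range] at h
  exact h

/-- **The nullity-`2` class partition**: `m[k + 1, k − 1] = Σ_{5 ≤ s ≤ k + 1} #nuSets (k + 1) 2 s`. -/
theorem sRow2 (hpairs : ∀ e ∈ M.E, ∀ f ∈ M.E, e ≠ f → M.eRk {e, f} = 2)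
    (hlines : ∀ L ⊆ M.E, M.eRk L = 2 → L.ncard ≤ 3) (hE2 : 2 ≤ M.E.ncard) (k : ℕ) (hk : 1 ≤ k) :
    (S1.rkSets M (k + 1) (k - 1)).ncard = ∑ i ∈ Finset.range (k + 2 - 5), (nuSets M (k + 1) 2 (5 + i)).ncard := by
  have h := ncard_rkSets_eq_sum_nuSets (M := M) k (k - 1) (by omega)
  have e : k + 1 - (k - 1) = 2 := by omega
  rw [e, sum_range_nuSets_two_eq hpairs hlines hE2 k hk, sum_Icc_eq_sum_range] at h
  exact h

/-- **The class partition at nullity `ν`**: `m[k + 1, k + 1 − ν] = Σ_{s ≤ k + 1} #nuSets (k + 1) ν s`. -/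
theorem sRowN (k ν : ℕ) (h : ν ≤ k + 1) :
    (S1.rkSets M (k + 1) (k + 1 - ν)).ncard = ∑ s ∈ Finset.range (k + 2), (nuSets M (k + 1) ν s).ncard := by
  have h' := ncard_rkSets_eq_sum_nuSets (M := M) k (k + 1 - ν) (by omega)
  rw [Nat.sub_sub_self h] at h'
  exact h'

/-- **The extension row**: `#nuSets k ν s ≤ C(n − s, k − s) · #nuSets s ν s`. -/
theorem eRow {n : ℕ} (hn : M.E.ncard = n) (k ν s C : ℕ) (hνk : ν ≤ k) (hC : Nat.choose (n - s) (k - s) = C) :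
    (nuSets M k ν s).ncard ≤ C * (nuSets M s ν s).ncard := by
  have h := ncard_nuSets_le_mul_choose (M := M) (k := k) (ν := ν) (s := s) hνk
  rw [hn, hC, mul_comm] at h
  exact h

/-- **The exact upward identity at nullity `0`**: `(n − k) m[k, k] = (k + 1) m[k + 1, k + 1] + Σ_{s ≥ 3} s · #nuSets (k + 1) 1 s`. -/
theorem upx0 {n : ℕ} (hpairs : ∀ e ∈ M.E, ∀ f ∈ M.E, e ≠ f → M.eRk {e, f} = 2) (hE2 : 2 ≤ M.E.ncard)
    (hn : M.E.ncard = n) (k : ℕ) :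
    (n - k) * (S1.rkSets M k k).ncard =
      (k + 1) * (S1.rkSets M (k + 1) (k + 1)).ncard +
        ∑ i ∈ Finset.range (k + 2 - 3), (3 + i) * (nuSets M (k + 1) 1 (3 + i)).ncard := by
  have h := up_exact (M := M) k k le_rfl
  rw [hn, Nat.sub_self, sum_range_nuSets_zero_eq k, zero_add, sum_range_mul_nuSets_one_eq hpairs hE2 k,
    sum_Icc_eq_sum_range] at h
  exact h

/-- **The exact upward identity at nullity `1`**. -/
theorem upx1 {n : ℕ} (hpairs : ∀ e ∈ M.E, ∀ f ∈ M.E, e ≠ f → M.eRk {e, f} = 2)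
    (hlines : ∀ L ⊆ M.E, M.eRk L = 2 → L.ncard ≤ 3) (hE2 : 2 ≤ M.E.ncard) (hn : M.E.ncard = n) (k : ℕ) (hk : 1 ≤ k) :
    (n - k) * (S1.rkSets M k (k - 1)).ncard =
      ∑ i ∈ Finset.range (k + 2 - 3), (k + 1 - (3 + i)) * (nuSets M (k + 1) 1 (3 + i)).ncard +
        ∑ i ∈ Finset.range (k + 2 - 5), (5 + i) * (nuSets M (k + 1) 2 (5 + i)).ncard := by
  have h := up_exact (M := M) k (k - 1) (Nat.sub_le k 1)
  have e1 : k - (k - 1) = 1 := by omega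
  have e2 : (1 + 1 : ℕ) = 2 := rfl
  rw [hn, e1, e2, sum_range_mul'_nuSets_one_eq hpairs hE2 k, sum_range_mul_nuSets_two_eq hpairs hlines hE2 k hk,
    sum_Icc_eq_sum_range, sum_Icc_eq_sum_range] at h
  exact h

/-- **The exact upward identity at nullity `ν`** (untrimmed). -/
theorem upxN {n : ℕ} (hn : M.E.ncard = n) (k ν : ℕ) (h : ν ≤ k) :
    (n - k) * (S1.rkSets M k (k - ν)).ncard =
      ∑ s ∈ Finset.range (k + 2), (k + 1 - s) * (nuSets M (k + 1) ν s).ncard +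
        ∑ s ∈ Finset.range (k + 2), s * (nuSets M (k + 1) (ν + 1) s).ncard := by
  have h' := up_exact (M := M) k (k - ν) (Nat.sub_le k ν)
  rw [hn, Nat.sub_sub_self h] at h'
  exact h'

section ClosureExact

/-- **The exact closure instance at nullity `0`, any set**: `Σ_{s ≥ 3} s · #nuSets (k + 1) 1 s ≤ (n − k) m[k, k]`. -/
theorem clx0_any {n : ℕ} (hpairs : ∀ e ∈ M.E, ∀ f ∈ M.E, e ≠ f → M.eRk {e, f} = 2) (hE2 : 2 ≤ M.E.ncard) (hn : M.E.ncard = n) (k : ℕ) :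
    ∑ i ∈ Finset.range (k + 2 - 3), (3 + i) * (nuSets M (k + 1) 1 (3 + i)).ncard ≤
      (n - k) * (S1.rkSets M k k).ncard := by
  have h := cl_exact_any (M := M) k k le_rfl
  rw [hn, Nat.sub_self, zero_add, sum_range_mul_nuSets_one_eq hpairs hE2 k, sum_Icc_eq_sum_range] at h
  exact h

/-- **The exact closure instance at nullity `0`, the coloop-free bound**. -/
theorem clx0_col {p n : ℕ} (hpairs : ∀ e ∈ M.E, ∀ f ∈ M.E, e ≠ f → M.eRk {e, f} = 2) (hE2 : 2 ≤ M.E.ncard) (hM : M.eRank = (p : ℕ∞)) (hcol : M.coloops = ∅) (hn : M.E.ncard = n) (k : ℕ)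
    (hkp : k < p) :
    ∑ i ∈ Finset.range (k + 2 - 3), (3 + i) * (nuSets M (k + 1) 1 (3 + i)).ncard ≤
      (n - (p - k + 1) - k) * (S1.rkSets M k k).ncard := by
  have h := cl_exact_coloops (M := M) hM hcol k k le_rfl hkp
  rw [hn, Nat.sub_self, zero_add, sum_range_mul_nuSets_one_eq hpairs hE2 k, sum_Icc_eq_sum_range] at h
  exact h

/-- **The exact closure instance at nullity `0`, the flat bound**. -/
theorem clx0_flat {b F : ℕ} (hpairs : ∀ e ∈ M.E, ∀ f ∈ M.E, e ≠ f → M.eRk {e, f} = 2) (hE2 : 2 ≤ M.E.ncard) (hflat : ∀ X ⊆ M.E, M.eRk X ≤ (b : ℕ∞) → X.ncard ≤ F) (k : ℕ) (hbk : b = k) :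
    ∑ i ∈ Finset.range (k + 2 - 3), (3 + i) * (nuSets M (k + 1) 1 (3 + i)).ncard ≤
      (F - k) * (S1.rkSets M k k).ncard := by
  subst hbk
  have h := cl_exact_flat (M := M) hflat b le_rfl
  rw [Nat.sub_self, zero_add, sum_range_mul_nuSets_one_eq hpairs hE2 b, sum_Icc_eq_sum_range] at h
  exact h

/-- **The exact closure instance at nullity `1`, any set**. -/
theorem clx1_any {n : ℕ} (hpairs : ∀ e ∈ M.E, ∀ f ∈ M.E, e ≠ f → M.eRk {e, f} = 2)
    (hlines : ∀ L ⊆ M.E, M.eRk L = 2 → L.ncard ≤ 3) (hE2 : 2 ≤ M.E.ncard) (hn : M.E.ncard = n) (k : ℕ) (hk : 1 ≤ k) :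
    ∑ i ∈ Finset.range (k + 2 - 5), (5 + i) * (nuSets M (k + 1) 2 (5 + i)).ncard ≤
      (n - k) * (S1.rkSets M k (k - 1)).ncard := by
  have h := cl_exact_any (M := M) k (k - 1) (Nat.sub_le k 1)
  have e2 : k - (k - 1) + 1 = 2 := by omega
  rw [hn, e2, sum_range_mul_nuSets_two_eq hpairs hlines hE2 k hk, sum_Icc_eq_sum_range] at h
  exact h

/-- **The exact closure instance at nullity `1`, the coloop-free bound**. -/
theorem clx1_col {p n : ℕ} (hpairs : ∀ e ∈ M.E, ∀ f ∈ M.E, e ≠ f → M.eRk {e, f} = 2)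
    (hlines : ∀ L ⊆ M.E, M.eRk L = 2 → L.ncard ≤ 3) (hE2 : 2 ≤ M.E.ncard) (hM : M.eRank = (p : ℕ∞)) (hcol : M.coloops = ∅) (hn : M.E.ncard = n) (k : ℕ)
    (hk : 1 ≤ k) (hkp : k - 1 < p) :
    ∑ i ∈ Finset.range (k + 2 - 5), (5 + i) * (nuSets M (k + 1) 2 (5 + i)).ncard ≤
      (n - (p - (k - 1) + 1) - k) * (S1.rkSets M k (k - 1)).ncard := by
  have h := cl_exact_coloops (M := M) hM hcol k (k - 1) (Nat.sub_le k 1) hkp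
  have e2 : k - (k - 1) + 1 = 2 := by omega
  rw [hn, e2, sum_range_mul_nuSets_two_eq hpairs hlines hE2 k hk, sum_Icc_eq_sum_range] at h
  exact h

/-- **The exact closure instance at nullity `1`, the flat bound**. -/
theorem clx1_flat {b F : ℕ} (hpairs : ∀ e ∈ M.E, ∀ f ∈ M.E, e ≠ f → M.eRk {e, f} = 2)
    (hlines : ∀ L ⊆ M.E, M.eRk L = 2 → L.ncard ≤ 3) (hE2 : 2 ≤ M.E.ncard) (hflat : ∀ X ⊆ M.E, M.eRk X ≤ (b : ℕ∞) → X.ncard ≤ F) (k : ℕ) (hk : 1 ≤ k)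
    (hbk : b = k - 1) :
    ∑ i ∈ Finset.range (k + 2 - 5), (5 + i) * (nuSets M (k + 1) 2 (5 + i)).ncard ≤
      (F - k) * (S1.rkSets M k (k - 1)).ncard := by
  subst hbk
  have h := cl_exact_flat (M := M) hflat k (Nat.sub_le k 1)
  have e2 : k - (k - 1) + 1 = 2 := by omega
  rw [e2, sum_range_mul_nuSets_two_eq hpairs hlines hE2 k hk, sum_Icc_eq_sum_range] at h
  exact h

/-- **The exact closure instance at nullity `ν`, any set** (untrimmed). -/
theorem clxN_any {n : ℕ} (hn : M.E.ncard = n) (k ν : ℕ) (h : ν ≤ k) :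
    ∑ s ∈ Finset.range (k + 2), s * (nuSets M (k + 1) (ν + 1) s).ncard ≤
      (n - k) * (S1.rkSets M k (k - ν)).ncard := by
  have h' := cl_exact_any (M := M) k (k - ν) (Nat.sub_le k ν)
  rw [hn, Nat.sub_sub_self h] at h'
  exact h'

/-- **The exact closure instance at nullity `ν`, the coloop-free bound** (untrimmed). -/
theorem clxN_col {p n : ℕ} (hM : M.eRank = (p : ℕ∞)) (hcol : M.coloops = ∅) (hn : M.E.ncard = n) (k ν : ℕ)
    (h : ν ≤ k) (hkp : k - ν < p) :
    ∑ s ∈ Finset.range (k + 2), s * (nuSets M (k + 1) (ν + 1) s).ncard ≤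
      (n - (p - (k - ν) + 1) - k) * (S1.rkSets M k (k - ν)).ncard := by
  have h' := cl_exact_coloops (M := M) hM hcol k (k - ν) (Nat.sub_le k ν) hkp
  rw [hn, Nat.sub_sub_self h] at h'
  exact h'

/-- **The exact closure instance at nullity `ν`, the flat bound** (untrimmed). -/
theorem clxN_flat {b F : ℕ} (hflat : ∀ X ⊆ M.E, M.eRk X ≤ (b : ℕ∞) → X.ncard ≤ F) (k ν : ℕ) (h : ν ≤ k)
    (hbk : b = k - ν) :
    ∑ s ∈ Finset.range (k + 2), s * (nuSets M (k + 1) (ν + 1) s).ncard ≤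
      (F - k) * (S1.rkSets M k (k - ν)).ncard := by
  subst hbk
  have h' := cl_exact_flat (M := M) hflat k (Nat.sub_le k ν)
  rw [Nat.sub_sub_self h] at h'
  exact h'

end ClosureExact

section ZeroClasses

/-- `m[k, r] = 0` for `k < r`. -/
theorem z_lt (k r : ℕ) (h : k < r) : (S1.rkSets M k r).ncard = 0 := by
  rw [S1.rkSets_eq_empty_of_lt h]; exact ncard_empty _

/-- `m[k, r] = 0` for `2 ≤ k`, `r < 2` (every pair is independent). -/
theorem z_two (hpairs : ∀ e ∈ M.E, ∀ f ∈ M.E, e ≠ f → M.eRk {e, f} = 2) (k r : ℕ) (hk : 2 ≤ k) (hr : r < 2) :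
    (S1.rkSets M k r).ncard = 0 := by
  rw [rkSets_eq_empty_of_lt_two hpairs hk hr]; exact ncard_empty _

omit [M.Finite] in
/-- `m[k, 2] = 0` for `3 < k` (lines have `≤ 3` points). -/
theorem z_lines (hlines : ∀ L ⊆ M.E, M.eRk L = 2 → L.ncard ≤ 3) (k : ℕ) (hk : 3 < k) :
    (S1.rkSets M k 2).ncard = 0 := by
  rw [S1.rkSets_eq_empty_of_lines hlines hk]; exact ncard_empty _

omit [M.Finite] in
/-- `m[k, r] = 0` for `r ≤ b`, `F < k` (the flats of rank `≤ b` have `≤ F` points). -/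
theorem z_flat {b F : ℕ} (hflat : ∀ X ⊆ M.E, M.eRk X ≤ (b : ℕ∞) → X.ncard ≤ F) (k r : ℕ) (hr : r ≤ b)
    (hk : F < k) : (S1.rkSets M k r).ncard = 0 := by
  rw [rkSets_eq_empty_of_flat hflat hr hk]; exact ncard_empty _

/-- `m[k, r] = 0` for `r < p`, `n < k + (p − r + 1)` (coloop-free). -/
theorem z_col {p n : ℕ} (hM : M.eRank = (p : ℕ∞)) (hcol : M.coloops = ∅) (hn : M.E.ncard = n) (k r : ℕ)
    (hr : r < p) (hk : n < k + (p - r + 1)) : (S1.rkSets M k r).ncard = 0 := by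
  rw [S1.rkSets_eq_empty_of_coloops hM hcol hn hr hk]; exact ncard_empty _

/-- `#nuSets k 0 s = 0` for `1 ≤ s`. -/
theorem nz_zero (k s : ℕ) (hs : 1 ≤ s) : (nuSets M k 0 s).ncard = 0 := by
  rw [nuSets_zero_eq_empty k s hs]; exact ncard_empty _

/-- `#nuSets k ν s = 0` for `s < ν + 2` (a nullity-`ν ≥ 1` core has `≥ ν + 2` points). -/
theorem nz_two (hpairs : ∀ e ∈ M.E, ∀ f ∈ M.E, e ≠ f → M.eRk {e, f} = 2) (hE2 : 2 ≤ M.E.ncard) (k ν s : ℕ)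
    (hν : 1 ≤ ν) (hνk : ν ≤ k) (hs : s < ν + 2) : (nuSets M k ν s).ncard = 0 := by
  rw [nuSets_eq_empty_of_lt_two hpairs hE2 hν hνk hs]; exact ncard_empty _

/-- `#nuSets k ν s = 0` for `2 ≤ ν`, `s < ν + 3`. -/
theorem nz_three (hpairs : ∀ e ∈ M.E, ∀ f ∈ M.E, e ≠ f → M.eRk {e, f} = 2)
    (hlines : ∀ L ⊆ M.E, M.eRk L = 2 → L.ncard ≤ 3) (hE2 : 2 ≤ M.E.ncard) (k ν s : ℕ) (hν : 2 ≤ ν) (hνk : ν ≤ k)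
    (hs : s < ν + 3) : (nuSets M k ν s).ncard = 0 := by
  rw [nuSets_eq_empty_of_lt_three_of_lines hpairs hlines hE2 hν hνk hs]; exact ncard_empty _

/-- `#nuSets k ν s = 0` for `4 ≤ ν`, `s < ν + 4`. -/
theorem nz_four (hpairs : ∀ e ∈ M.E, ∀ f ∈ M.E, e ≠ f → M.eRk {e, f} = 2)
    (hlines : ∀ L ⊆ M.E, M.eRk L = 2 → L.ncard ≤ 3) (hplanes : ∀ P ⊆ M.E, M.eRk P ≤ 3 → P.ncard ≤ 6)
    (hE2 : 2 ≤ M.E.ncard) (k ν s : ℕ) (hν : 4 ≤ ν) (hνk : ν ≤ k) (hs : s < ν + 4) : (nuSets M k ν s).ncard = 0 := by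
  rw [nuSets_eq_empty_of_lt_four_of_planes hpairs hlines hplanes hE2 hν hνk hs]; exact ncard_empty _

/-- `#nuSets k ν s = 0` for `7 ≤ ν`, `s < ν + 5`. -/
theorem nz_five (hpairs : ∀ e ∈ M.E, ∀ f ∈ M.E, e ≠ f → M.eRk {e, f} = 2)
    (hlines : ∀ L ⊆ M.E, M.eRk L = 2 → L.ncard ≤ 3) (hplanes : ∀ P ⊆ M.E, M.eRk P ≤ 3 → P.ncard ≤ 6)
    (htens : ∀ X ⊆ M.E, M.eRk X ≤ 4 → X.ncard ≤ 10) (hE2 : 2 ≤ M.E.ncard) (k ν s : ℕ) (hν : 7 ≤ ν) (hνk : ν ≤ k)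
    (hs : s < ν + 5) : (nuSets M k ν s).ncard = 0 := by
  rw [nuSets_eq_empty_of_lt_five_of_tens hpairs hlines hplanes htens hE2 hν hνk hs]; exact ncard_empty _

/-- `#nuSets k ν s = 0` for `15 ≤ ν`, `s < ν + 6`. -/
theorem nz_six (hpairs : ∀ e ∈ M.E, ∀ f ∈ M.E, e ≠ f → M.eRk {e, f} = 2)
    (hlines : ∀ L ⊆ M.E, M.eRk L = 2 → L.ncard ≤ 3) (hplanes : ∀ P ⊆ M.E, M.eRk P ≤ 3 → P.ncard ≤ 6)
    (htens : ∀ X ⊆ M.E, M.eRk X ≤ 4 → X.ncard ≤ 10) (hnineteen : ∀ X ⊆ M.E, M.eRk X ≤ 5 → X.ncard ≤ 19)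
    (hE2 : 2 ≤ M.E.ncard) (k ν s : ℕ) (hν : 15 ≤ ν) (hνk : ν ≤ k) (hs : s < ν + 6) : (nuSets M k ν s).ncard = 0 := by
  rw [nuSets_eq_empty_of_lt_six_of_nineteen hpairs hlines hplanes htens hnineteen hE2 hν hνk hs]; exact ncard_empty _

/-- `#nuSets k ν s = 0` when the rank class `m[k, k − ν]` is empty. -/
theorem nz_rk (k ν s r : ℕ) (hr : r = k - ν) (h : (S1.rkSets M k r).ncard = 0) : (nuSets M k ν s).ncard = 0 := by
  subst hr
  exact Nat.le_zero.1 ((ncard_le_ncard (fun _ h => h.1) (S1.rkSets_finite k (k - ν))).trans (le_of_eq h))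

/-- **The unsplit upward row at nullity `0`**: `(n − k) m[k, k] ≤ (k + 1) m[k + 1, k + 1] + (k + 1) m[k + 1, k]` (the exact
identity `upx0` with every core size `s ≤ k + 1`). -/
theorem upTop {n : ℕ} (hn : M.E.ncard = n) (k : ℕ) :
    (n - k) * (S1.rkSets M k k).ncard ≤
      (k + 1) * (S1.rkSets M (k + 1) (k + 1)).ncard + (k + 1) * (S1.rkSets M (k + 1) k).ncard := by
  have h := up_exact (M := M) k k le_rfl
  rw [hn, Nat.sub_self, sum_range_nuSets_zero_eq k, zero_add] at h
  have h2 : ∑ s ∈ Finset.range (k + 2), s * (nuSets M (k + 1) 1 s).ncard ≤ (k + 1) * (S1.rkSets M (k + 1) k).ncard := by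
    rw [ncard_rkSets_eq_sum_nuSets (M := M) k k (by omega), Nat.add_sub_cancel_left, Finset.mul_sum]
    apply Finset.sum_le_sum
    intro s hs
    have hs' : s ≤ k + 1 := by
      simp only [Finset.mem_range] at hs
      omega
    exact Nat.mul_le_mul_right _ hs'
  rw [h]
  exact Nat.add_le_add_left h2 _

end ZeroClasses

end S3LP

end PercRepro
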